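import Literature.IUT.HodgeArakelov.BadPrimeGaussianMonoidsGenuineRecordRestrictionIsoProofs
import Literature.IUT.HodgeArakelov.EtaleThetaDataOfSettingGaloisUnits

/-!
# [IUTchII] Cor 3.5 (ii) "⥲" AT THE GENUINE RECORD over the constants `ℚ̄_pˣ` acted on through `ε`: the two Kummer
# injectivity inputs (K) of the restriction isomorphism DISCHARGED — residual = `horb` and the theta EVALUATION (E)

S. Mochizuki, *Inter-universal Teichmüller theory II*, kurims Dec-2020 manuscript, Cor 3.5 (ii) p. 95, Cor 3.5 (i) p. 94,
Prop 3.1 (ii) p. 88 ("`Ψ_cns(M^Θ_*) := M_TM(M^Θ_*) ⊆ lim_J H¹(Π_Ÿ(M^Θ_*)|_J, Π_μ(M^Θ_*))` … naturally isomorphic to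
`O^▷_{F̄_v}`") [cite: Mochizuki2012, Cor 3.5 (ii) p.95]. Claim key DISPUTED (D-0012). PROOF-ONLY companion (abc-iut
cell, layer L6, seat abc-iut-w4-d004 gen 3; node **IUTchII:Cor3.5(ii)**, restriction-ISO clause, sub-DAG row
Cor-35.ii.r12). NO definition, NO `Prop` fact, NO instance.

SEQUEL to `…GenuineRecordRestrictionIsoProofs.lean` (this seat), whose `exists_unique_restrictionIso'_thetaEnvRecordKummer`
produces the Cor 3.5 (ii) isomorphism at the genuine record `EtaleLevels.thetaEnvRecordKummer` for an ABSTRACT constants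
module `A` with the inputs (K) `hκ`, `hκ₀` (injectivity of the Kummer maps over `Π^tp_{Ÿ̲̲}` and over `G_v`). HERE the
constants module is abc-iut-w4-d007's model `A := ℚ̄_pˣ = (PadicAlgCl p)ˣ` acted on by `Π^tp_{X̲̲}` through
`ε : Π^tp_{X̲̲} → G_{ℚ_p}` (`EtaleThetaDataOfSetting.unitsAction`), and by `G_v = P₀` through the evaluation sections
(`hact`), and both inputs are THEOREMS of Kummer theory of the MLF:
* `hκ_padic` — `κ = h1LimKummerOn c … O` over `Π^tp_{Ÿ̲̲}` is injective for every bijective coefficient datum `c`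
  (abc-iut-w4-d007 `EtaleThetaDataOfSetting.h1LimKummer_injective_of_coeff`; `ε(Π^tp_{Ÿ̲̲})` has finite index);
* `hκ₀_padic` — `κ₀ = h1LimKummerOn c₀ … O` over `G_v` is injective for every bijective `c₀`, `G_v` acting through a
  section `s_{t₁}` whose image has finite-index image under `ε` (a decomposition group: `ε(D_{t₁})` is open in `G_K`)
  (abc-iut-w4-d007 `h1LimKummer_top_injective_of_aug` for the augmentation `ε ∘ s_{t₁}` of `G_v`);
* **`exists_unique_restrictionIso'_thetaEnvRecordKummer_padic`** — the Cor 3.5 (ii) isomorphism at the genuine record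
  over `ℚ̄_pˣ` with (K), (R), `hU`, `hUsurj`, `hinj`, `hq₀` ALL DERIVED: inputs = the evaluation-sections data (`s_t`,
  `φ₀`, `hact`, one section with finite-index `ε`-image), the model data (`c`, `c₀` bijective, `O`), `horb`, and
  **(E) the theta evaluation `R_t θ = κ₀ (q_t)` with `q_{t₀}` a non-unit** (Cor 2.8 (i) / [EtTh] Prop 1.4 (iii)).
Nothing here asserts a disputed claim or takes a side on [IUTchIII] Cor 3.12; typed ≠ proved ≠ endorsed.
-/

noncomputable section

namespace Literature.IUT.HodgeArakelov

namespace EtaleLevels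

open Literature.AnabelianGeometry.EtaleTheta CohomologySystemOfContH1 EtaleThetaDataOfSetting TemperedThetaMonoids
  BadPrimeGaussianMonoids

variable {p : ℕ} [Fact p.Prime] {D : Literature.AnabelianGeometry.EtaleTheta.ThetaSetting p}
  {E : D.EtaleThetaData} {l : ℕ} (C : E.DoubleUnderline l) (hC : D.Compat) (hS : D.Sec2Hyps)
  (hl : l.Prime) (hp2 : p ≠ 2) (hpl : p ≠ l) (hζ : ∃ ζ : D.K, IsPrimitiveRoot ζ (4 * l))
  (mods : ∀ M : ℕ+, D.CyclotomeMod l M)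
  (f : contCocycles D.toTheta D.DeltaTheta C.GtpYdduu) (hf : f ∈ C.rootCocycles hC)
  (hmods : ∀ (M M' : ℕ+) (h : (M : ℕ) ∣ (M' : ℕ)) (x : D.lDeltaTheta l),
    MuN.red p M M' h ((mods M').red x) = (mods M).red x)
  (h15 : Literature.AnabelianGeometry.EtaleTheta.ThetaSetting.Prop15iii E hC) (L : C.CuspLabels)
  (hZ : ∀ M : ℕ+, Nonempty (ModelCyclotomes.lDeltaQuot (C.rigidData (mods M) hC hS h15 L) ≃*
    Literature.IUT.HodgeTheaters.ZHat))
  (hcharY : EtaleThetaDataOfSetting.PiYddCharacteristic C)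
  (hlim : Function.Bijective (rigidLimHom C hC hS hl hp2 hpl hζ mods f hf hmods h15 L hZ))
  [(EtaleThetaDataOfSetting.PiYdd C).Normal]
  [TopologicalSpace (PadicAlgCl p)ˣ]
  (c : CyclotomeCoefficients (phi C) (D.lDeltaTheta l) (PadicAlgCl p)ˣ)
  (hA : ∀ b : (PadicAlgCl p)ˣ, IsOpen (MulAction.stabilizer (Pi C) b : Set (Pi C)))
  (hfi : ∀ b : (PadicAlgCl p)ˣ, (MulAction.stabilizer (Pi C) b).FiniteIndex)
  (O : Submonoid (PadicAlgCl p)ˣ) (ι₀ : Pi C)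
  {Lbl : Type*} {P₀ : TopGroup.{0}} (φ₀ : P₀ →* D.GtpTheta) (s : Lbl → (P₀ →* Pi C))
  (hι : ∀ t, Continuous ((MonoidHom.id (Pi C)).comp (s t)))
  (hN : ∀ t, (⊤ : Subgroup P₀).map ((MonoidHom.id (Pi C)).comp (s t)) ≤ PiYdd C)
  (hφ : ∀ t, (phi C).comp ((MonoidHom.id (Pi C)).comp (s t)) = φ₀)
  [MulDistribMulAction P₀ (PadicAlgCl p)ˣ]
  (c₀ : CyclotomeCoefficients φ₀ (D.lDeltaTheta l) (PadicAlgCl p)ˣ)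
  (hA₀ : ∀ b : (PadicAlgCl p)ˣ, IsOpen (MulAction.stabilizer P₀ b : Set P₀))
  (hfi₀ : ∀ b : (PadicAlgCl p)ˣ, (MulAction.stabilizer P₀ b).FiniteIndex)

omit [(EtaleThetaDataOfSetting.PiYdd C).Normal] in
/-- **(K), first half, at `A = ℚ̄_pˣ`**: the Kummer map `κ = h1LimKummerOn c … O` of the constants over `Π^tp_{Ÿ̲̲}` into
the genuine limit is INJECTIVE for every bijective coefficient datum `c` ("`Ψ_cns := M_TM ⊆ lim_J H¹(…)`";
abc-iut-w4-d007 `h1LimKummer_injective_of_coeff`, `ε(Π^tp_{Ÿ̲̲})` of finite index). [cite: Mochizuki2012, Prop 3.1 (ii) p.88] -/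
theorem hκ_padic (hc : Function.Bijective c.hom) :
    Function.Injective (h1LimKummerOn (phi C) (D.lDeltaTheta l) (PiYdd C) c hA hfi O) :=
  h1LimKummerOn_injective (phi C) (D.lDeltaTheta l) (PiYdd C) c hA hfi O
    (EtaleThetaDataOfSetting.h1LimKummer_injective_of_coeff C (phi C) (D.lDeltaTheta l) c (PiYdd C) hc)

omit [(EtaleThetaDataOfSetting.PiYdd C).Normal] [TopologicalSpace (PadicAlgCl p)ˣ]
  [MulDistribMulAction P₀ (PadicAlgCl p)ˣ] in
include hι in
/-- Continuity of the evaluation sections (bookkeeping: `(id ∘ s_t)` is `s_t`). [cite: Mochizuki2012, Cor 2.4 (ii) p.70] -/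
theorem continuous_section (t : Lbl) : Continuous (s t) := by
  have h := hι t
  exact h

omit [(EtaleThetaDataOfSetting.PiYdd C).Normal] in
include hι in
/-- **(K), second half, at `A = ℚ̄_pˣ`**: the `G_v`-LEVEL Kummer map `κ₀ = h1LimKummerOn c₀ … O` over `G_v = P₀` is
INJECTIVE for every bijective `c₀`, `G_v` acting on `ℚ̄_pˣ` through an evaluation section `s_{t₁}` (`hact`) whose image
has finite-index image under `ε` (a decomposition group `D_{t₁}`: `ε(D_{t₁}) = G_{K_{t₁}}` open in `G_K`) — Kummer theory
of the MLF (abc-iut-w4-d007 `h1LimKummer_top_injective_of_aug` for the augmentation `ε ∘ s_{t₁}`).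
[cite: Mochizuki2012, Cor 3.5 (i) p.94] -/
theorem hκ₀_padic (hc₀ : Function.Bijective c₀.hom) (t₁ : Lbl)
    (hact : ∀ (g : P₀) (a : (PadicAlgCl p)ˣ), g • a = s t₁ g • a)
    [((EtaleThetaDataOfSetting.aug C).comp (s t₁)).range.FiniteIndex] :
    Function.Injective (h1LimKummerOn φ₀ (D.lDeltaTheta l) ⊤ c₀ hA₀ hfi₀ O) := by
  have haug : ∀ (g : P₀) (u : ((padicMLF p).K)ˣ),
      ((g • u : ((padicMLF p).K)ˣ) : (padicMLF p).K) = ((EtaleThetaDataOfSetting.aug C).comp (s t₁)) g (u : _) := by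
    intro g u
    rw [hact g u]
    exact units_coe_smul' C (s t₁ g) u
  have hcont : Continuous ((EtaleThetaDataOfSetting.aug C).comp (s t₁)) :=
    (continuous_aug C).comp (continuous_section C s hι t₁)
  have hinj := h1LimKummer_top_injective_of_aug (padicMLF p) ((EtaleThetaDataOfSetting.aug C).comp (s t₁)) haug
    φ₀ (D.lDeltaTheta l) hcont c₀ hc₀
  exact h1LimKummerOn_injective φ₀ (D.lDeltaTheta l) ⊤ c₀ hA₀ hfi₀ O hinj

/-- **IUTchII:Cor3.5(ii)** (kurims p.95) "`Ψ^ι_env(M^Θ_*) ⥲ Ψ_ξ(M^Θ_*)`" **AT THE GENUINE RECORD over `ℚ̄_pˣ`**: the UNIQUE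
isomorphism `Ψ^{ι₀}_env(𝕄_*) ⥲ Ψ_ξ ⊆ ∏_t κ₀(O)` pinned to the restrictions along the evaluation sections, with the
junction hypotheses (K) (both Kummer injectivities), (R), `hU`, `hUsurj`, `hinj`, `hq₀` ALL DERIVED. Inputs: the
sections data (`s_t` continuous into `Π^tp_{Ÿ̲̲}`, common `φ₀`, `G_v`'s action through the sections `hact`, one section
with finite-index `ε`-image), the model data (`c`, `c₀` bijective; the constant monoid `O ≤ ℚ̄_pˣ`, e.g. `𝒪^▷`), `horb`
(`θ^{ι₀}_env` one `M^×_TM`-orbit), and **(E) `R_t θ = κ₀ (q_t)` with `q_{t₀}` a non-unit** — the theta EVALUATION of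
Cor 2.8 (i) / [EtTh] Prop 1.4 (iii), THE residual of the node. [cite: Mochizuki2012, Cor 3.5 (ii) p.95] -/
theorem exists_unique_restrictionIso'_thetaEnvRecordKummer_padic (hc : Function.Bijective c.hom)
    (hc₀ : Function.Bijective c₀.hom) (hc₀c : ∀ ζ, c₀.hom ζ = c.hom ζ)
    (hact : ∀ (t : Lbl) (g : P₀) (a : (PadicAlgCl p)ˣ), g • a = s t g • a) (t₁ : Lbl)
    [((EtaleThetaDataOfSetting.aug C).comp (s t₁)).range.FiniteIndex]
    {i₀ : Pi C}
    {θ : (thetaEnvRecordKummer C hC hS hl hp2 hpl hζ mods f hf hmods h15 L hZ hcharY hlim c hA hfi O ι₀).H}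
    (hθ : θ ∈ (thetaEnvRecordKummer C hC hS hl hp2 hpl hζ mods f hf hmods h15 L hZ hcharY hlim c hA hfi O ι₀).thetaEnv i₀)
    (horb : ∀ θ' ∈ (thetaEnvRecordKummer C hC hS hl hp2 hpl hζ mods f hf hmods h15 L hZ hcharY hlim c hA hfi O
        ι₀).thetaEnv i₀,
      ∃ u ∈ (thetaEnvRecordKummer C hC hS hl hp2 hpl hζ mods f hf hmods h15 L hZ hcharY hlim c hA hfi O ι₀).units,
        θ' = u * θ)
    (R : Lbl → ((thetaEnvRecordKummer C hC hS hl hp2 hpl hζ mods f hf hmods h15 L hZ hcharY hlim c hA hfi O ι₀).H →*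
      Multiplicative (h1Lim φ₀ (D.lDeltaTheta l) (⊤ : Subgroup P₀) ⊥)))
    (hR : ∀ t y, Multiplicative.toAdd (R t y) =
      h1LimCongr (D.lDeltaTheta l) ⊤ (hφ t) ⊥
        (h1LimComap (phi C) (D.lDeltaTheta l) ((MonoidHom.id (Pi C)).comp (s t)) (hι t) (hN t)
          (AddEquiv.additiveMultiplicative (h1Lim (phi C) (D.lDeltaTheta l) (PiYdd C) ⊥) (Additive.ofMul y))))
    (q : Lbl → O)
    (hRθ : ∀ t, R t θ = h1LimKummerOn φ₀ (D.lDeltaTheta l) ⊤ c₀ hA₀ hfi₀ O (q t))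
    (t₀ : Lbl) (hq : ¬ IsUnit (q t₀)) :
    ∃! e : (thetaEnvRecordKummer C hC hS hl hp2 hpl hζ mods f hf hmods h15 L hZ hcharY hlim c hA hfi O ι₀).thetaMonoid i₀ ≃*
        gaussianMonoid (fun t =>
          ((R t).comp ((thetaEnvRecordKummer C hC hS hl hp2 hpl hζ mods f hf hmods h15 L hZ hcharY hlim c hA hfi O
              ι₀).thetaMonoid i₀).subtype).codRestrict
            (MonoidHom.mrange (h1LimKummerOn φ₀ (D.lDeltaTheta l) ⊤ c₀ hA₀ hfi₀ O))
            (restriction_mem_mrange_gen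
              (thetaEnvRecordKummer C hC hS hl hp2 hpl hζ mods f hf hmods h15 L hZ hcharY hlim c hA hfi O ι₀)
              (h1LimKummerOn (phi C) (D.lDeltaTheta l) (PiYdd C) c hA hfi O)
              (h1LimKummerOn φ₀ (D.lDeltaTheta l) ⊤ c₀ hA₀ hfi₀ O)
              (fun t => (R t).comp ((thetaEnvRecordKummer C hC hS hl hp2 hpl hζ mods f hf hmods h15 L hZ hcharY hlim c
                hA hfi O ι₀).thetaMonoid i₀).subtype)
              q (hκ_padic C c hA hfi O hc) (ThetaEnvData.toRecord_constantMonoid _ _ _ _) hθ horb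
              (fun t m hm => hRκ_thetaEnvRecordKummer C hC hS hl hp2 hpl hζ mods f hf hmods h15 L hZ hcharY hlim c hA
                hfi O ι₀ φ₀ s hι hN hφ c₀ hA₀ hfi₀ hc₀c hact R hR t m hm)
              (fun t => hRθ t) t)
            ⟨θ, thetaEnv_subset_thetaMonoid
              (thetaEnvRecordKummer C hC hS hl hp2 hpl hζ mods f hf hmods h15 L hZ hcharY hlim c hA hfi O ι₀) i₀ hθ⟩),
      ∀ x, ((e x : gaussianMonoid _) : Lbl → MonoidHom.mrange (h1LimKummerOn φ₀ (D.lDeltaTheta l) ⊤ c₀ hA₀ hfi₀ O)) =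
        MonoidHom.pi (fun t =>
          ((R t).comp ((thetaEnvRecordKummer C hC hS hl hp2 hpl hζ mods f hf hmods h15 L hZ hcharY hlim c hA hfi O
              ι₀).thetaMonoid i₀).subtype).codRestrict
            (MonoidHom.mrange (h1LimKummerOn φ₀ (D.lDeltaTheta l) ⊤ c₀ hA₀ hfi₀ O))
            (restriction_mem_mrange_gen
              (thetaEnvRecordKummer C hC hS hl hp2 hpl hζ mods f hf hmods h15 L hZ hcharY hlim c hA hfi O ι₀)
              (h1LimKummerOn (phi C) (D.lDeltaTheta l) (PiYdd C) c hA hfi O)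
              (h1LimKummerOn φ₀ (D.lDeltaTheta l) ⊤ c₀ hA₀ hfi₀ O)
              (fun t => (R t).comp ((thetaEnvRecordKummer C hC hS hl hp2 hpl hζ mods f hf hmods h15 L hZ hcharY hlim c
                hA hfi O ι₀).thetaMonoid i₀).subtype)
              q (hκ_padic C c hA hfi O hc) (ThetaEnvData.toRecord_constantMonoid _ _ _ _) hθ horb
              (fun t m hm => hRκ_thetaEnvRecordKummer C hC hS hl hp2 hpl hζ mods f hf hmods h15 L hZ hcharY hlim c hA
                hfi O ι₀ φ₀ s hι hN hφ c₀ hA₀ hfi₀ hc₀c hact R hR t m hm)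
              (fun t => hRθ t) t)) x :=
  haveI := ‹((EtaleThetaDataOfSetting.aug C).comp (s t₁)).range.FiniteIndex›
  exists_unique_restrictionIso'_thetaEnvRecordKummer C hC hS hl hp2 hpl hζ mods f hf hmods h15 L hZ hcharY hlim c hA
    hfi O ι₀ φ₀ s hι hN hφ c₀ hA₀ hfi₀ hc₀c hact (hκ_padic C c hA hfi O hc)
    (hκ₀_padic (C := C) (O := O) (φ₀ := φ₀) (s := s) (hι := hι) (c₀ := c₀) (hA₀ := hA₀) (hfi₀ := hfi₀) hc₀ t₁ (hact t₁)) hθ horb R hR q hRθ t₀ hq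

end EtaleLevels

end Literature.IUT.HodgeArakelov

end
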